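import Summits.HodgeConjecture.HodgeConjecture.Theorems.H413E2SWBorelBoundNarrowC
import Literature.NumberTheory.Weil1964.AdelicDoublingGeometricFrameBorelMp
import Literature.NumberTheory.Automorphic.UnitaryDualPairDoubledLineAdelicAction
import Literature.NumberTheory.Automorphic.UnitaryDualPairDoubledLineFrames
import HarnessLib

/-!
# Crux H413, E-2 child line `F0_E2SiegelWeilWeilRange`, row SW2c-BOUND: (**)′ IN THE δ♮-FRAME OF THE DOUBLED PAIR —
# `exists_borelBound_of_lemma20_of_dominated` at the cell's `j`, with the real-ray letter (RAY) DISCHARGED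

HC_CM is proved only modulo the printed citations until rung 0 closes; nothing in this file is about HC.  Cell `hodgecm-mathlib`,
floor 0, programme P4, engine E-2, item stmt-HodgeConjecture-24833 (`--supports`); seat F0P4-p07 (g3); sheet `F0/P4/SW2c-BOUND-ASSEMBLY.v1`
(8e2768b2) §B (J)/(RAY), A4 of its landing order.

THE OBJECTS (all ★): the doubled Gram matrix `𝕋 = doubledGramFin F T`, `T = adelicGram F e T_V T_W`, of the child line; its metaplectic group
`Mp = adelicMpCont F (Fin (n+n)) 𝕋`; the `W□`-member `U_D = U(T_W ⊕ −T_W)(𝔸_F)` (★ `DoubledUnitaryRankOneReductionDiag`); a `W`-side hom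
`jS : U_D →* Sp(T ⊕ −T)` into the SUM model agreeing with the pair embedding `ι_{eD}(1 ⊗ ·)` (★ `UnitaryGroup.exists_sumModelHom`, A-p16 (g18) —
entered as the hypothesis `hjS`, its first conjunct); a frame element `u₀ ∈ Mp` acting by the frame chirp `t(C₀)` (★ `exists_frameUnipPair`,
A-p12 (g13) — hypothesis `hu₀`); Li's `δ` lifted, `doublingDeltaLift` (★ `AdelicDoublingDiagonalLift`).  THE HOM OF RECORD is
  `j := conj(π u₀ · π(doublingDeltaLift)) ∘ spReindex_{finSumFinEquiv} ∘ jS : U_D →* Sp(𝕎□_𝔸, 𝕋)`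
(entered as `hj : j = …` so that consumers instantiate by `rfl`).

THE THEOREM `exists_borelBound_frame`: ★ `E2SWBorelBoundNarrowC.exists_borelBound_of_lemma20_of_dominated` at this `j`, with its hypothesis
(RAY) PROVED: for `r ≥ 1` the real-ray Levi element `b = d(z_E r) = M·diag(z_E r, (z_E r)⁻¹)·M⁻¹ ∈ U_D` has the lift
`g = u₀ · 𝐫₀ᶜᵒⁿᵗ(P_b) · u₀⁻¹`, `P_b = δ̃ · jS b · δ̃⁻¹ ∈ P_𝕐(𝔸)` (★ `stabDiagParabolicFin`; `jS b ∈ Stab(W^Δ)` by ★ `mem_stabDiag_of_apply_diag`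
from the vector action ★ `toSp_adelicInr_cayley_conj_diag_posRealIdele_apply`, A-p16), over `j b` (★ `proj_conj_adelicSiegelLiftCont`) and acting by
the dilation `twistLM (posRealScalar (n+n) F r)` (★ (J-D) `omega_conj_adelicSiegelLiftCont_of_realRay`, A-p12).  The remaining hypotheses are the
four STRUCTURE letters of sheet v1 §B at this `j`: (INV) `hINV`, (IMPL)+(DOM-C) `hIMPL`, (Î) `hI`/`h𝒴`/`hL`, (E_X) `hEE`/`hEEmono`/`hsplit`.

References: A. Weil, *Sur la formule de Siegel dans la théorie des groupes classiques*, Acta Math. 113 (1965), n° 47 Lemme 20, n° 48, n° 50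
[Weil1965]; A. Weil, *Sur certains groupes d'opérateurs unitaires*, Acta Math. 111 (1964), Chap. I n° 13 p. 160, Chap. III n° 41 [Weil1964];
J.-S. Li, J. reine angew. Math. 428 (1992), p. 181 [Li1992].
-/

set_option autoImplicit false

noncomputable section

set_option linter.dupNamespace false

namespace Summit.HodgeConjecture.HodgeConjecture.Cruxes.H413.E2SWBorelBoundFrame

open scoped NNReal ENNReal Matrix
open _root_.MeasureTheory NumberField IsDedekindDomain Matrix
open Literature.RepresentationTheory.HeisenbergGroup
open Literature.NumberTheory.Weil1964 Literature.NumberTheory.Weil1965 Literature.NumberTheory.Automorphic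
open Literature.NumberTheory.Automorphic.DoubledUnitary.RankOneReduction
open Literature.NumberTheory.Automorphic.UnitaryGroup
open Literature.NumberTheory.GelbartRogawski1991 Literature.NumberTheory.GelbartRogawski1991.UnitaryDualPair

variable (F E : Type) [Field F] [NumberField F] [Field E] [NumberField E] [Algebra F E] [Algebra.IsQuadraticExtension F E]
  (c : E ≃ₐ[F] E) {δ : E} (hcδ : c δ = -δ) (hδ : δ ≠ 0) {d : F} (hd : δ * δ = algebraMap F E d)
  (N : ℕ) {n : ℕ} (e : Fin N × Fin 1 ≃ Fin n)
  {TV : Matrix (Fin N) (Fin N) F} (TW : Matrix (Fin 1) (Fin 1) F) (hV : TV.IsSymm)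
  (hW2 : (Matrix.reindex finSumFinEquiv finSumFinEquiv (Matrix.fromBlocks TW 0 0 (-TW))).IsSymm)
  (hVd : IsUnit TV.det) (hWd : IsUnit TW.det)

/-- `↑(posRealScalar m F r) = ↑(posRealIdele F r) • 1` (the real scalar matrix; public form of the private lemma of
★ `SiegelWeilNarrowRayBound`). [folklore] -/
theorem coe_posRealScalar_eq_smul_one (m : ℕ) (r : ℝ≥0ˣ) :
    ((posRealScalar m F r : GL (Fin m) (AdeleRing (𝓞 F) F)) : Matrix (Fin m) (Fin m) (AdeleRing (𝓞 F) F)) =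
      ((posRealIdele F r : (AdeleRing (𝓞 F) F)ˣ) : AdeleRing (𝓞 F) F) • (1 : Matrix (Fin m) (Fin m) (AdeleRing (𝓞 F) F)) := by
  ext i j
  change Matrix.diagonal (fun _ => ((posRealIdele F r : (AdeleRing (𝓞 F) F)ˣ) : AdeleRing (𝓞 F) F)) i j = _
  rw [Matrix.smul_apply, Matrix.one_apply, Matrix.diagonal_apply, smul_eq_mul, mul_ite, mul_one, mul_zero]

/-- `d(z_E r)⁻¹ = d(z_E r⁻¹)` for the Levi element `d(u) = M·diag(u, u⁻¹)·M⁻¹` of the real ray. [cite: Weil1965, n° 47 Lemme 20 (p. 67)] -/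
theorem cayley_conj_diag_posRealIdele_inv (M : GL (Fin 2) (AdeleRing (𝓞 E) E)) (r : ℝ≥0ˣ) :
    (M * glDiagonal 2 (AdeleRing (𝓞 E) E) ![posRealIdele E r, (posRealIdele E r)⁻¹] * M⁻¹)⁻¹ =
      M * glDiagonal 2 (AdeleRing (𝓞 E) E) ![posRealIdele E r⁻¹, (posRealIdele E r⁻¹)⁻¹] * M⁻¹ := by
  have hvec : (![posRealIdele E r, (posRealIdele E r)⁻¹] : Fin 2 → (AdeleRing (𝓞 E) E)ˣ)⁻¹ =
      ![posRealIdele E r⁻¹, (posRealIdele E r⁻¹)⁻¹] := by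
    funext i
    fin_cases i
    · simp [map_inv]
    · simp [map_inv]
  rw [_root_.mul_inv_rev, _root_.mul_inv_rev, inv_inv, ← map_inv, hvec, mul_assoc]

/-- `a · (d · s · d⁻¹) · a⁻¹ = (a · d) · s · (a · d)⁻¹` in any group. [folklore] -/
theorem mul_conj_mul_inv_eq {G : Type*} [Group G] (a d s : G) : a * (d * s * d⁻¹) * a⁻¹ = a * d * s * (a * d)⁻¹ := by
  group

/-- **`π` of the frame lift of a diagonal-stabilising element**: for `g ∈ Stab(W^Δ)` (sum model) and the frame element `u₀`,
`π(u₀ · 𝐫₀ᶜᵒⁿᵗ(δ̃ g δ̃⁻¹) · u₀⁻¹) = (π u₀ · π(doublingDeltaLift)) · spReindex g · (π u₀ · π(doublingDeltaLift))⁻¹` — i.e. the lift lies over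
`j g` for `j = conj(π u₀ · δ̃) ∘ spReindex` (term-mode chain: no rewriting inside metaplectic terms). [cite: Weil1964, Chap. I n° 13 p. 160] [cite: Li1992, p. 181] -/
theorem proj_frameLift_eq (T : Matrix (Fin n) (Fin n) (AdeleRing (𝓞 F) F)) (hT : IsUnit T.det)
    (u₀ : adelicMpCont F (Fin (n + n)) (doubledGramFin F T))
    (g : symplecticGroup (polar (Matrix.toLinearMap₂' (AdeleRing (𝓞 F) F) (Matrix.fromBlocks T 0 0 (-T)))))
    (hg : g ∈ stabDiag T) :
    adelicMpCont.proj F (Fin (n + n)) (doubledGramFin F T)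
        (u₀ * adelicSiegelLiftCont F (doubledGramFin F T) (isUnit_det_doubledGramFin F T hT) (stabDiagParabolicFin F T hT ⟨g, hg⟩) * u₀⁻¹) =
      adelicMpCont.proj F (Fin (n + n)) (doubledGramFin F T) u₀ * adelicMpCont.proj F (Fin (n + n)) (doubledGramFin F T) (doublingDeltaLift F T hT) *
        spReindex (finSumFinEquiv : Fin n ⊕ Fin n ≃ Fin (n + n)) (Matrix.fromBlocks T 0 0 (-T)) g *
        (adelicMpCont.proj F (Fin (n + n)) (doubledGramFin F T) u₀ *
          adelicMpCont.proj F (Fin (n + n)) (doubledGramFin F T) (doublingDeltaLift F T hT))⁻¹ := by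
  -- `↑P = δ̃ · spReindex g · δ̃⁻¹`, `δ̃ = spReindex δ = π(doublingDeltaLift)`
  have h4 : spReindex (finSumFinEquiv : Fin n ⊕ Fin n ≃ Fin (n + n)) (Matrix.fromBlocks T 0 0 (-T)) (doublingDelta T hT) =
      adelicMpCont.proj F (Fin (n + n)) (doubledGramFin F T) (doublingDeltaLift F T hT) := (proj_doublingDeltaLift F T hT).symm
  have hP : ((stabDiagParabolicFin F T hT ⟨g, hg⟩ : siegelParabolicPi (doubledGramFin F T)) :
      symplecticGroup (polar (adelicForm F (Fin (n + n)) (doubledGramFin F T)))) =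
      adelicMpCont.proj F (Fin (n + n)) (doubledGramFin F T) (doublingDeltaLift F T hT) *
        spReindex (finSumFinEquiv : Fin n ⊕ Fin n ≃ Fin (n + n)) (Matrix.fromBlocks T 0 0 (-T)) g *
        (adelicMpCont.proj F (Fin (n + n)) (doubledGramFin F T) (doublingDeltaLift F T hT))⁻¹ :=
    (coe_stabDiagParabolicFin F T hT ⟨g, hg⟩).trans
      (((map_mul (spReindex (finSumFinEquiv : Fin n ⊕ Fin n ≃ Fin (n + n)) (Matrix.fromBlocks T 0 0 (-T))) _ _).trans
        (congrArg₂ (· * ·) (map_mul (spReindex (finSumFinEquiv : Fin n ⊕ Fin n ≃ Fin (n + n)) (Matrix.fromBlocks T 0 0 (-T))) _ _)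
          (map_inv (spReindex (finSumFinEquiv : Fin n ⊕ Fin n ≃ Fin (n + n)) (Matrix.fromBlocks T 0 0 (-T))) _))).trans
        (congrArg₂ (fun A B => A * spReindex (finSumFinEquiv : Fin n ⊕ Fin n ≃ Fin (n + n)) (Matrix.fromBlocks T 0 0 (-T)) g * B⁻¹) h4 h4))
  exact (proj_conj_adelicSiegelLiftCont F T hT (stabDiagParabolicFin F T hT ⟨g, hg⟩) u₀).trans
    ((congrArg (fun X => adelicMpCont.proj F (Fin (n + n)) (doubledGramFin F T) u₀ * X *
      (adelicMpCont.proj F (Fin (n + n)) (doubledGramFin F T) u₀)⁻¹) hP).trans (mul_conj_mul_inv_eq _ _ _))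

/-- **The sum-model action of the real-ray Levi element** `d(z_E r) = M·diag(z_E r, (z_E r)⁻¹)·M⁻¹` through `jS`:
`(w₁, w₂) ↦ (½(z(w₁+w₂) + z⁻¹(w₁−w₂)), ½(z(w₁+w₂) − z⁻¹(w₁−w₂)))`, `z = z_F(r)` (★ A-p16 `toSp_adelicInr_cayley_conj_diag_posRealIdele_apply`
read through `hjS` and `reindexW`). [cite: Weil1965, n° 47 Lemme 20 (p. 67)] -/
theorem sumModel_apply_sumElim_realRay (hTW : TW 0 0 ≠ 0)
    (jS : ↥(UnitaryGroup.adelic F E c (1 + 1)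
        ((Matrix.reindex finSumFinEquiv finSumFinEquiv (Matrix.fromBlocks TW 0 0 (-TW))).map (algebraMap F E))) →*
      ↥(symplecticGroup (polar (Matrix.toLinearMap₂' (AdeleRing (𝓞 F) F)
        (Matrix.fromBlocks (adelicGram F e TV TW) 0 0 (-adelicGram F e TV TW))))))
    (hjS : ∀ (A : ↥(UnitaryGroup.adelic F E c (1 + 1)
        ((Matrix.reindex finSumFinEquiv finSumFinEquiv (Matrix.fromBlocks TW 0 0 (-TW))).map (algebraMap F E))))
        (v : (Fin (n + n) → AdeleRing (𝓞 F) F) × (Fin (n + n) → AdeleRing (𝓞 F) F)),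
      ((spReindex (finSumFinEquiv : Fin n ⊕ Fin n ≃ Fin (n + n))
          (Matrix.fromBlocks (adelicGram F e TV TW) 0 0 (-adelicGram F e TV TW)) (jS A) :
          symplecticGroup (polar (Matrix.toLinearMap₂' (AdeleRing (𝓞 F) F)
            (Matrix.reindex finSumFinEquiv finSumFinEquiv
              (Matrix.fromBlocks (adelicGram F e TV TW) 0 0 (-adelicGram F e TV TW)))))) :
        ((Fin (n + n) → AdeleRing (𝓞 F) F) × (Fin (n + n) → AdeleRing (𝓞 F) F)) ≃ₗ[AdeleRing (𝓞 F) F]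
          ((Fin (n + n) → AdeleRing (𝓞 F) F) × (Fin (n + n) → AdeleRing (𝓞 F) F))) v =
      ((toSp F E c N (1 + 1)
          (((Equiv.prodCongr (Equiv.refl (Fin N)) finSumFinEquiv.symm).trans (Equiv.prodSumDistrib (Fin N) (Fin 1) (Fin 1))).trans
            ((Equiv.sumCongr e e).trans finSumFinEquiv))
          (TV.map (algebraMap F E)) ((Matrix.reindex finSumFinEquiv finSumFinEquiv (Matrix.fromBlocks TW 0 0 (-TW))).map (algebraMap F E))
          hcδ hδ hd hV hW2 rfl rfl
          (adelicInr F E c N (1 + 1) (TV.map (algebraMap F E))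
            ((Matrix.reindex finSumFinEquiv finSumFinEquiv (Matrix.fromBlocks TW 0 0 (-TW))).map (algebraMap F E)) A) :
          symplecticGroup (polar (adelicForm F (Fin (n + n))
            (adelicGram F
              (((Equiv.prodCongr (Equiv.refl (Fin N)) finSumFinEquiv.symm).trans (Equiv.prodSumDistrib (Fin N) (Fin 1) (Fin 1))).trans
                ((Equiv.sumCongr e e).trans finSumFinEquiv)) TV
              (Matrix.reindex finSumFinEquiv finSumFinEquiv (Matrix.fromBlocks TW 0 0 (-TW))))))) :
        ((Fin (n + n) → AdeleRing (𝓞 F) F) × (Fin (n + n) → AdeleRing (𝓞 F) F)) ≃ₗ[AdeleRing (𝓞 F) F]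
          ((Fin (n + n) → AdeleRing (𝓞 F) F) × (Fin (n + n) → AdeleRing (𝓞 F) F))) v)
    {M : GL (Fin 2) (AdeleRing (𝓞 E) E)}
    (hM : (M : Matrix (Fin 2) (Fin 2) (AdeleRing (𝓞 E) E)) =
      !![1, algebraMap E (AdeleRing (𝓞 E) E) (algebraMap F E (2 * TW 0 0)⁻¹);
        1, -algebraMap E (AdeleRing (𝓞 E) E) (algebraMap F E (2 * TW 0 0)⁻¹)])
    (r : ℝ≥0ˣ) (x₁ x₂ y₁ y₂ : Fin n → AdeleRing (𝓞 F) F) :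
    ((jS ⟨M * glDiagonal 2 (AdeleRing (𝓞 E) E) ![posRealIdele E r, (posRealIdele E r)⁻¹] * M⁻¹,
        cayley_conj_diag_posRealIdele_mem_adelic F E c TW hTW hM r⟩ :
        symplecticGroup (polar (Matrix.toLinearMap₂' (AdeleRing (𝓞 F) F)
          (Matrix.fromBlocks (adelicGram F e TV TW) 0 0 (-adelicGram F e TV TW))))) :
        ((Fin n ⊕ Fin n → AdeleRing (𝓞 F) F) × (Fin n ⊕ Fin n → AdeleRing (𝓞 F) F)) ≃ₗ[AdeleRing (𝓞 F) F]
          ((Fin n ⊕ Fin n → AdeleRing (𝓞 F) F) × (Fin n ⊕ Fin n → AdeleRing (𝓞 F) F))) (Sum.elim x₁ x₂, Sum.elim y₁ y₂) =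
      (Sum.elim
          (⅟(2 : AdeleRing (𝓞 F) F) • ((((posRealIdele F r : (AdeleRing (𝓞 F) F)ˣ) : AdeleRing (𝓞 F) F) • (x₁ + x₂)) +
              (((posRealIdele F r)⁻¹ : (AdeleRing (𝓞 F) F)ˣ) : AdeleRing (𝓞 F) F) • (x₁ - x₂)))
          (⅟(2 : AdeleRing (𝓞 F) F) • ((((posRealIdele F r : (AdeleRing (𝓞 F) F)ˣ) : AdeleRing (𝓞 F) F) • (x₁ + x₂)) -
              (((posRealIdele F r)⁻¹ : (AdeleRing (𝓞 F) F)ˣ) : AdeleRing (𝓞 F) F) • (x₁ - x₂))),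
        Sum.elim
          (⅟(2 : AdeleRing (𝓞 F) F) • ((((posRealIdele F r : (AdeleRing (𝓞 F) F)ˣ) : AdeleRing (𝓞 F) F) • (y₁ + y₂)) +
              (((posRealIdele F r)⁻¹ : (AdeleRing (𝓞 F) F)ˣ) : AdeleRing (𝓞 F) F) • (y₁ - y₂)))
          (⅟(2 : AdeleRing (𝓞 F) F) • ((((posRealIdele F r : (AdeleRing (𝓞 F) F)ˣ) : AdeleRing (𝓞 F) F) • (y₁ + y₂)) -
              (((posRealIdele F r)⁻¹ : (AdeleRing (𝓞 F) F)ˣ) : AdeleRing (𝓞 F) F) • (y₁ - y₂)))) := by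
  have h := hjS ⟨M * glDiagonal 2 (AdeleRing (𝓞 E) E) ![posRealIdele E r, (posRealIdele E r)⁻¹] * M⁻¹,
      cayley_conj_diag_posRealIdele_mem_adelic F E c TW hTW hM r⟩
    (reindexW (AdeleRing (𝓞 F) F) (finSumFinEquiv : Fin n ⊕ Fin n ≃ Fin (n + n)) (Sum.elim x₁ x₂, Sum.elim y₁ y₂))
  rw [coe_spReindex_apply, LinearEquiv.symm_apply_apply,
    toSp_adelicInr_cayley_conj_diag_posRealIdele_apply F E c hcδ hδ hd N e TW hV hW2 hTW hM r x₁ x₂ y₁ y₂] at h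
  exact (reindexW (AdeleRing (𝓞 F) F) (finSumFinEquiv : Fin n ⊕ Fin n ≃ Fin (n + n))).injective h

set_option maxHeartbeats 400000 in
/-- **(**)′ IN THE δ♮-FRAME OF THE DOUBLED PAIR, (RAY) DISCHARGED.**  See the module docstring.  Conclusion: one constant `M` with
`‖E″(ω(p)Φ)‖ ≤ M · √L(p)` for every `p ∈ Mp` lying over `j b`, `b ∈ U_D` a Borel element (`b₀₀ + b₀₁ = b₁₀ + b₁₁`), where
`j = conj(π u₀ · π(doublingDeltaLift)) ∘ spReindex ∘ jS`. [cite: Weil1965, n° 47 Lemme 20, n° 48 Lemmes 21–23, n° 50]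
[cite: Weil1964, Chap. I n° 13 p. 160] [cite: Li1992, p. 181] -/
theorem exists_borelBound_frame [IsTotallyReal F] [IsGalois F E] (h2 : ∀ σ : E ≃ₐ[F] E, σ = 1 ∨ σ = c) (hTW : TW 0 0 ≠ 0)
    (hTs : (adelicGram F e TV TW).IsSymm)
    [MeasurableSpace (AdeleRing (𝓞 F) F)] [BorelSpace (AdeleRing (𝓞 F) F)]
    (ν : Measure (Fin (n + n) → AdeleRing (𝓞 F) F)) [ν.IsAddHaarMeasure]
    (E'' : piSchwartzBruhat F (Fin (n + n)) →ₗ[ℂ] ℂ) (Φ : piSchwartzBruhat F (Fin (n + n)))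
    -- the frame chirp as an element of `Mp` (★ `exists_frameUnipPair`)
    (u₀ : adelicMpCont F (Fin (n + n)) (doubledGramFin F (adelicGram F e TV TW)))
    (hu₀ : ∀ Ψ : piSchwartzBruhat F (Fin (n + n)),
      ((adelicMpCont.omega F (Fin (n + n)) (doubledGramFin F (adelicGram F e TV TW)) u₀ Ψ : piSchwartzBruhat F (Fin (n + n))) :
          (Fin (n + n) → AdeleRing (𝓞 F) F) → ℂ) =
        chirp F (ratMatrix F (frameHalfRat F)) (Ψ : (Fin (n + n) → AdeleRing (𝓞 F) F) → ℂ))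
    -- the `W`-side hom into the sum model (★ `exists_sumModelHom`, first conjunct)
    (jS : ↥(UnitaryGroup.adelic F E c (1 + 1)
        ((Matrix.reindex finSumFinEquiv finSumFinEquiv (Matrix.fromBlocks TW 0 0 (-TW))).map (algebraMap F E))) →*
      ↥(symplecticGroup (polar (Matrix.toLinearMap₂' (AdeleRing (𝓞 F) F)
        (Matrix.fromBlocks (adelicGram F e TV TW) 0 0 (-adelicGram F e TV TW))))))
    (hjS : ∀ (A : ↥(UnitaryGroup.adelic F E c (1 + 1)
        ((Matrix.reindex finSumFinEquiv finSumFinEquiv (Matrix.fromBlocks TW 0 0 (-TW))).map (algebraMap F E))))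
        (v : (Fin (n + n) → AdeleRing (𝓞 F) F) × (Fin (n + n) → AdeleRing (𝓞 F) F)),
      ((spReindex (finSumFinEquiv : Fin n ⊕ Fin n ≃ Fin (n + n))
          (Matrix.fromBlocks (adelicGram F e TV TW) 0 0 (-adelicGram F e TV TW)) (jS A) :
          symplecticGroup (polar (Matrix.toLinearMap₂' (AdeleRing (𝓞 F) F)
            (Matrix.reindex finSumFinEquiv finSumFinEquiv
              (Matrix.fromBlocks (adelicGram F e TV TW) 0 0 (-adelicGram F e TV TW)))))) :
        ((Fin (n + n) → AdeleRing (𝓞 F) F) × (Fin (n + n) → AdeleRing (𝓞 F) F)) ≃ₗ[AdeleRing (𝓞 F) F]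
          ((Fin (n + n) → AdeleRing (𝓞 F) F) × (Fin (n + n) → AdeleRing (𝓞 F) F))) v =
      ((toSp F E c N (1 + 1)
          (((Equiv.prodCongr (Equiv.refl (Fin N)) finSumFinEquiv.symm).trans (Equiv.prodSumDistrib (Fin N) (Fin 1) (Fin 1))).trans
            ((Equiv.sumCongr e e).trans finSumFinEquiv))
          (TV.map (algebraMap F E)) ((Matrix.reindex finSumFinEquiv finSumFinEquiv (Matrix.fromBlocks TW 0 0 (-TW))).map (algebraMap F E))
          hcδ hδ hd hV hW2 rfl rfl
          (adelicInr F E c N (1 + 1) (TV.map (algebraMap F E))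
            ((Matrix.reindex finSumFinEquiv finSumFinEquiv (Matrix.fromBlocks TW 0 0 (-TW))).map (algebraMap F E)) A) :
          symplecticGroup (polar (adelicForm F (Fin (n + n))
            (adelicGram F
              (((Equiv.prodCongr (Equiv.refl (Fin N)) finSumFinEquiv.symm).trans (Equiv.prodSumDistrib (Fin N) (Fin 1) (Fin 1))).trans
                ((Equiv.sumCongr e e).trans finSumFinEquiv)) TV
              (Matrix.reindex finSumFinEquiv finSumFinEquiv (Matrix.fromBlocks TW 0 0 (-TW))))))) :
        ((Fin (n + n) → AdeleRing (𝓞 F) F) × (Fin (n + n) → AdeleRing (𝓞 F) F)) ≃ₗ[AdeleRing (𝓞 F) F]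
          ((Fin (n + n) → AdeleRing (𝓞 F) F) × (Fin (n + n) → AdeleRing (𝓞 F) F))) v)
    -- THE HOM OF RECORD `j = conj(π u₀ · π(doublingDeltaLift)) ∘ spReindex ∘ jS`
    (j : ↥(UnitaryGroup.adelic F E c (1 + 1)
        ((Matrix.reindex finSumFinEquiv finSumFinEquiv (Matrix.fromBlocks TW 0 0 (-TW))).map (algebraMap F E))) →*
      ↥(symplecticGroup (polar (adelicForm F (Fin (n + n)) (doubledGramFin F (adelicGram F e TV TW))))))
    (hj : j = (MulAut.conj (adelicMpCont.proj F (Fin (n + n)) (doubledGramFin F (adelicGram F e TV TW)) u₀ *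
        adelicMpCont.proj F (Fin (n + n)) (doubledGramFin F (adelicGram F e TV TW))
          (doublingDeltaLift F (adelicGram F e TV TW) (isUnit_det_adelicGram F e hVd hWd)))).toMonoidHom.comp
      ((spReindex (finSumFinEquiv : Fin n ⊕ Fin n ≃ Fin (n + n))
        (Matrix.fromBlocks (adelicGram F e TV TW) 0 0 (-adelicGram F e TV TW))).comp jS))
    -- (INV): rational elements have isometric `E″`-invariant lifts over `j`
    (hINV : ∀ (γ : GL (Fin (1 + 1)) (AdeleRing (𝓞 E) E))
      (hγ : γ ∈ UnitaryGroup.adelic F E c (1 + 1)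
        ((Matrix.reindex finSumFinEquiv finSumFinEquiv (Matrix.fromBlocks TW 0 0 (-TW))).map (algebraMap F E))),
      γ ∈ (Matrix.GeneralLinearGroup.map (algebraMap E (AdeleRing (𝓞 E) E))).range →
      ∃ r : adelicMpCont F (Fin (n + n)) (doubledGramFin F (adelicGram F e TV TW)),
        adelicMpCont.proj F (Fin (n + n)) (doubledGramFin F (adelicGram F e TV TW)) r = j ⟨γ, hγ⟩ ∧
        adelicMpCont.l2Scaling F (doubledGramFin F (adelicGram F e TV TW))
          (isUnit_det_doubledGramFin F (adelicGram F e TV TW) (isUnit_det_adelicGram F e hVd hWd)) ν r = 1 ∧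
        E'' ∘ₗ adelicMpCont.omega F (Fin (n + n)) (doubledGramFin F (adelicGram F e TV TW)) r⁻¹ = E'')
    -- (IMPL) + (DOM-C): implementers over `j` of every compact `C ⊆ U_D`, moduli `≥ c₁ > 0`, ONE dominating Schwartz–Bruhat function
    (hIMPL : ∀ C : Set (GL (Fin (1 + 1)) (AdeleRing (𝓞 E) E)), IsCompact C →
      ∀ hCU : C ⊆ UnitaryGroup.adelic F E c (1 + 1)
        ((Matrix.reindex finSumFinEquiv finSumFinEquiv (Matrix.fromBlocks TW 0 0 (-TW))).map (algebraMap F E)),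
      ∃ q : GL (Fin (1 + 1)) (AdeleRing (𝓞 E) E) → adelicMpCont F (Fin (n + n)) (doubledGramFin F (adelicGram F e TV TW)),
        (∀ (k : GL (Fin (1 + 1)) (AdeleRing (𝓞 E) E)) (hk : k ∈ C),
          adelicMpCont.proj F (Fin (n + n)) (doubledGramFin F (adelicGram F e TV TW)) (q k) = j ⟨k, hCU hk⟩) ∧
        (∃ c₁ : ℝ, 0 < c₁ ∧ ∀ k ∈ C, c₁ ≤ (adelicMpCont.l2Scaling F (doubledGramFin F (adelicGram F e TV TW))
          (isUnit_det_doubledGramFin F (adelicGram F e TV TW) (isUnit_det_adelicGram F e hVd hWd)) ν (q k)).toReal) ∧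
        ∃ Φ₀ : piSchwartzBruhat F (Fin (n + n)), ∀ k ∈ C, ∀ x,
          ‖((adelicMpCont.omega F (Fin (n + n)) (doubledGramFin F (adelicGram F e TV TW)) (q k) Φ : piSchwartzBruhat F (Fin (n + n))) :
              (Fin (n + n) → AdeleRing (𝓞 F) F) → ℂ) x‖ ≤
            (((Φ₀ : piSchwartzBruhat F (Fin (n + n))) : (Fin (n + n) → AdeleRing (𝓞 F) F) → ℂ) x).re)
    -- the (Î)/(E_X) structure of `E″`
    {Sr : Matrix (Fin (n + n)) (Fin (n + n)) F} (hSr : Sr.IsSymm) (hSrdet : Sr.det ≠ 0)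
    (EI EE : piSchwartzBruhat F (Fin (n + n)) →ₗ[ℂ] ℂ) (κ : ℝ≥0∞) (hκ : κ ≠ ⊤)
    (hsplit : ∀ Ψ : piSchwartzBruhat F (Fin (n + n)), (‖E'' Ψ‖ₑ : ℝ≥0∞) ≤ ‖EI Ψ‖ₑ + κ * ‖EE Ψ‖ₑ)
    {ι : Type*} (Ω : Set ι) (L : ι → GL (Fin (n + n)) (AdeleRing (𝓞 F) F)) (cI : ℝ≥0∞) (hcI : cI ≠ ⊤)
    (hI : ∀ (Ψ : piSchwartzBruhat F (Fin (n + n))) (B : ℝ≥0∞),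
      (∀ h ∈ Ω, ∑' v : ↥{v : Fin (n + n) → F | v ≠ 0},
        (‖(Ψ : (Fin (n + n) → AdeleRing (𝓞 F) F) → ℂ) (ratVec F (v : Fin (n + n) → F) ᵥ*
          (L h : Matrix (Fin (n + n)) (Fin (n + n)) (AdeleRing (𝓞 F) F)))‖ₑ : ℝ≥0∞) ≤ B) → (‖EI Ψ‖ₑ : ℝ≥0∞) ≤ cI * B)
    {𝒴 : Set (GL (Fin (n + n)) (FiniteAdeleRing (𝓞 F) F))} (h𝒴 : IsCompact 𝒴) {H₀ : ℝ}
    (hL : ∀ h ∈ Ω, GLn.sndHom (n + n) F (L h) ∈ 𝒴 ∧ (GLn.archHeight (n + n) F (L h) : ℝ) ≤ H₀)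
    (hEE : ∀ Ψ : piSchwartzBruhat F (Fin (n + n)), (‖EE Ψ‖ₑ : ℝ≥0∞) ≤
      ∑' ξ : F, (‖∫ x, chirp F ((algebraMap F (AdeleRing (𝓞 F) F) ξ) • ratMatrix F Sr)
        ((Ψ : piSchwartzBruhat F (Fin (n + n))) : (Fin (n + n) → AdeleRing (𝓞 F) F) → ℂ) x ∂ν‖ₑ : ℝ≥0∞))
    (hEEmono : ∀ Ψ Ψ' : piSchwartzBruhat F (Fin (n + n)),
      (∀ x, ‖(Ψ : (Fin (n + n) → AdeleRing (𝓞 F) F) → ℂ) x‖ ≤ ((Ψ' : (Fin (n + n) → AdeleRing (𝓞 F) F) → ℂ) x).re) →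
        (‖EE Ψ‖ₑ : ℝ≥0∞) ≤ ‖EE Ψ'‖ₑ)
    (hn : 2 < n) :
    ∃ Mbound : ℝ, ∀ (p : adelicMpCont F (Fin (n + n)) (doubledGramFin F (adelicGram F e TV TW)))
      (b : GL (Fin (1 + 1)) (AdeleRing (𝓞 E) E))
      (hb : b ∈ UnitaryGroup.adelic F E c (1 + 1)
        ((Matrix.reindex finSumFinEquiv finSumFinEquiv (Matrix.fromBlocks TW 0 0 (-TW))).map (algebraMap F E))),
      (b : Matrix (Fin (1 + 1)) (Fin (1 + 1)) (AdeleRing (𝓞 E) E)) 0 0 + (b : Matrix (Fin (1 + 1)) (Fin (1 + 1)) (AdeleRing (𝓞 E) E)) 0 1 =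
        (b : Matrix (Fin (1 + 1)) (Fin (1 + 1)) (AdeleRing (𝓞 E) E)) 1 0 + (b : Matrix (Fin (1 + 1)) (Fin (1 + 1)) (AdeleRing (𝓞 E) E)) 1 1 →
      adelicMpCont.proj F (Fin (n + n)) (doubledGramFin F (adelicGram F e TV TW)) p = j ⟨b, hb⟩ →
      ‖E'' (adelicMpCont.omega F (Fin (n + n)) (doubledGramFin F (adelicGram F e TV TW)) p Φ)‖ ≤
        Mbound * Real.sqrt (adelicMpCont.l2Scaling F (doubledGramFin F (adelicGram F e TV TW))
          (isUnit_det_doubledGramFin F (adelicGram F e TV TW) (isUnit_det_adelicGram F e hVd hWd)) ν p).toReal := by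
  have hm : 4 < n + n := by omega
  refine E2SWBorelBoundNarrowC.exists_borelBound_of_lemma20_of_dominated F E c TW h2 (Units.mk0 δ hδ) hcδ hTW
    (doubledGramFin F (adelicGram F e TV TW))
    (isUnit_det_doubledGramFin F (adelicGram F e TV TW) (isUnit_det_adelicGram F e hVd hWd)) ν E'' Φ j hINV ?_ hIMPL
    hSr hSrdet EI EE κ hκ hsplit Ω L cI hcI hI h𝒴 hL hEE hEEmono hm
  -- (RAY): the real-ray Levi element `b = d(z_E r)`, `r ≥ 1`, lifts to `u₀ · 𝐫₀ᶜᵒⁿᵗ(P_b) · u₀⁻¹`, acting by `twistLM (posRealScalar (n+n) F r)`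
  intro M hM r _
  -- the sum-model element `g = jS ⟨b, _⟩` and its action on `W ⊕ W⁻` (and that of its inverse, `= jS ⟨d(z_E r⁻¹), _⟩`)
  have hgv := sumModel_apply_sumElim_realRay F E c hcδ hδ hd N e TW hV hW2 hTW jS hjS hM r
  have hAinv : (⟨M * glDiagonal 2 (AdeleRing (𝓞 E) E) ![posRealIdele E r, (posRealIdele E r)⁻¹] * M⁻¹,
      cayley_conj_diag_posRealIdele_mem_adelic F E c TW hTW hM r⟩ :
        ↥(UnitaryGroup.adelic F E c (1 + 1)
          ((Matrix.reindex finSumFinEquiv finSumFinEquiv (Matrix.fromBlocks TW 0 0 (-TW))).map (algebraMap F E))))⁻¹ =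
      ⟨M * glDiagonal 2 (AdeleRing (𝓞 E) E) ![posRealIdele E r⁻¹, (posRealIdele E r⁻¹)⁻¹] * M⁻¹,
        cayley_conj_diag_posRealIdele_mem_adelic F E c TW hTW hM r⁻¹⟩ :=
    Subtype.ext (cayley_conj_diag_posRealIdele_inv E M r)
  have hgv' : ∀ x₁ x₂ y₁ y₂ : Fin n → AdeleRing (𝓞 F) F,
      ((jS ⟨M * glDiagonal 2 (AdeleRing (𝓞 E) E) ![posRealIdele E r, (posRealIdele E r)⁻¹] * M⁻¹,
          cayley_conj_diag_posRealIdele_mem_adelic F E c TW hTW hM r⟩ :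
          symplecticGroup (polar (Matrix.toLinearMap₂' (AdeleRing (𝓞 F) F)
            (Matrix.fromBlocks (adelicGram F e TV TW) 0 0 (-adelicGram F e TV TW))))) :
          ((Fin n ⊕ Fin n → AdeleRing (𝓞 F) F) × (Fin n ⊕ Fin n → AdeleRing (𝓞 F) F)) ≃ₗ[AdeleRing (𝓞 F) F]
            ((Fin n ⊕ Fin n → AdeleRing (𝓞 F) F) × (Fin n ⊕ Fin n → AdeleRing (𝓞 F) F))).symm (Sum.elim x₁ x₂, Sum.elim y₁ y₂) =
        (Sum.elim
            (⅟(2 : AdeleRing (𝓞 F) F) • ((((posRealIdele F r⁻¹ : (AdeleRing (𝓞 F) F)ˣ) : AdeleRing (𝓞 F) F) • (x₁ + x₂)) +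
                (((posRealIdele F r⁻¹)⁻¹ : (AdeleRing (𝓞 F) F)ˣ) : AdeleRing (𝓞 F) F) • (x₁ - x₂)))
            (⅟(2 : AdeleRing (𝓞 F) F) • ((((posRealIdele F r⁻¹ : (AdeleRing (𝓞 F) F)ˣ) : AdeleRing (𝓞 F) F) • (x₁ + x₂)) -
                (((posRealIdele F r⁻¹)⁻¹ : (AdeleRing (𝓞 F) F)ˣ) : AdeleRing (𝓞 F) F) • (x₁ - x₂))),
          Sum.elim
            (⅟(2 : AdeleRing (𝓞 F) F) • ((((posRealIdele F r⁻¹ : (AdeleRing (𝓞 F) F)ˣ) : AdeleRing (𝓞 F) F) • (y₁ + y₂)) +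
                (((posRealIdele F r⁻¹)⁻¹ : (AdeleRing (𝓞 F) F)ˣ) : AdeleRing (𝓞 F) F) • (y₁ - y₂)))
            (⅟(2 : AdeleRing (𝓞 F) F) • ((((posRealIdele F r⁻¹ : (AdeleRing (𝓞 F) F)ˣ) : AdeleRing (𝓞 F) F) • (y₁ + y₂)) -
                (((posRealIdele F r⁻¹)⁻¹ : (AdeleRing (𝓞 F) F)ˣ) : AdeleRing (𝓞 F) F) • (y₁ - y₂)))) := by
    intro x₁ x₂ y₁ y₂
    have hsymm : ((jS ⟨M * glDiagonal 2 (AdeleRing (𝓞 E) E) ![posRealIdele E r, (posRealIdele E r)⁻¹] * M⁻¹,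
          cayley_conj_diag_posRealIdele_mem_adelic F E c TW hTW hM r⟩ :
          symplecticGroup (polar (Matrix.toLinearMap₂' (AdeleRing (𝓞 F) F)
            (Matrix.fromBlocks (adelicGram F e TV TW) 0 0 (-adelicGram F e TV TW))))) :
          ((Fin n ⊕ Fin n → AdeleRing (𝓞 F) F) × (Fin n ⊕ Fin n → AdeleRing (𝓞 F) F)) ≃ₗ[AdeleRing (𝓞 F) F]
            ((Fin n ⊕ Fin n → AdeleRing (𝓞 F) F) × (Fin n ⊕ Fin n → AdeleRing (𝓞 F) F))).symm =
        ((jS ⟨M * glDiagonal 2 (AdeleRing (𝓞 E) E) ![posRealIdele E r⁻¹, (posRealIdele E r⁻¹)⁻¹] * M⁻¹,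
          cayley_conj_diag_posRealIdele_mem_adelic F E c TW hTW hM r⁻¹⟩ :
          symplecticGroup (polar (Matrix.toLinearMap₂' (AdeleRing (𝓞 F) F)
            (Matrix.fromBlocks (adelicGram F e TV TW) 0 0 (-adelicGram F e TV TW))))) :
          ((Fin n ⊕ Fin n → AdeleRing (𝓞 F) F) × (Fin n ⊕ Fin n → AdeleRing (𝓞 F) F)) ≃ₗ[AdeleRing (𝓞 F) F]
            ((Fin n ⊕ Fin n → AdeleRing (𝓞 F) F) × (Fin n ⊕ Fin n → AdeleRing (𝓞 F) F))) := by
      rw [← hAinv, map_inv]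
      rfl
    rw [hsymm]
    exact sumModel_apply_sumElim_realRay F E c hcδ hδ hd N e TW hV hW2 hTW jS hjS hM r⁻¹ x₁ x₂ y₁ y₂
  -- `g ∈ Stab(W^Δ)`: both `g` and `g⁻¹` carry diagonal vectors to diagonal vectors
  have hg : jS ⟨M * glDiagonal 2 (AdeleRing (𝓞 E) E) ![posRealIdele E r, (posRealIdele E r)⁻¹] * M⁻¹,
      cayley_conj_diag_posRealIdele_mem_adelic F E c TW hTW hM r⟩ ∈ stabDiag (adelicGram F e TV TW) := by
    refine mem_stabDiag_of_apply_diag (adelicGram F e TV TW) _ (fun x y => ?_) (fun x y => ?_)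
    · rw [hgv]
      simp only [sub_self, smul_zero, add_zero, sub_zero]
      exact isDiag_diag _ _
    · rw [hgv']
      simp only [sub_self, smul_zero, add_zero, sub_zero]
      exact isDiag_diag _ _
  -- the parabolic element `P_b = δ g δ⁻¹` renumbered (★ `stabDiagParabolicFin`) and the lift `u₀ · 𝐫₀ᶜᵒⁿᵗ P_b · u₀⁻¹`
  have hP := coe_stabDiagParabolicFin F (adelicGram F e TV TW) (isUnit_det_adelicGram F e hVd hWd) ⟨_, hg⟩
  refine ⟨u₀ * adelicSiegelLiftCont F (doubledGramFin F (adelicGram F e TV TW))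
      (isUnit_det_doubledGramFin F (adelicGram F e TV TW) (isUnit_det_adelicGram F e hVd hWd))
      (stabDiagParabolicFin F (adelicGram F e TV TW) (isUnit_det_adelicGram F e hVd hWd) ⟨_, hg⟩) * u₀⁻¹, ?_, fun Ψ => ?_⟩
  · -- over `j b = (π u₀ · π(doublingDeltaLift)) · spReindex (jS b) · (…)⁻¹`
    rw [hj]
    exact proj_frameLift_eq F (adelicGram F e TV TW) (isUnit_det_adelicGram F e hVd hWd) u₀ _ hg
  · -- the dilation: (J-D) on the real ray with `p₁ = z_F(r)⁻¹`, `p₂ = z_F(r)` (scalars of `g⁻¹` on `W^Δ`, `W^∇`)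
    have hp : ((posRealIdele F r⁻¹ : (AdeleRing (𝓞 F) F)ˣ) : AdeleRing (𝓞 F) F) *
        (((posRealIdele F r⁻¹)⁻¹ : (AdeleRing (𝓞 F) F)ˣ) : AdeleRing (𝓞 F) F) = 1 := Units.mul_inv _
    have hMz : ((posRealScalar (n + n) F r : GL (Fin (n + n)) (AdeleRing (𝓞 F) F)) :
        Matrix (Fin (n + n)) (Fin (n + n)) (AdeleRing (𝓞 F) F)) =
        (((posRealIdele F r⁻¹)⁻¹ : (AdeleRing (𝓞 F) F)ˣ) : AdeleRing (𝓞 F) F) • (1 : Matrix (Fin (n + n)) (Fin (n + n)) (AdeleRing (𝓞 F) F)) := by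
      rw [map_inv, inv_inv, coe_posRealScalar_eq_smul_one]
    exact omega_conj_adelicSiegelLiftCont_of_realRay F (adelicGram F e TV TW) (isUnit_det_adelicGram F e hVd hWd)
      (g := jS ⟨M * glDiagonal 2 (AdeleRing (𝓞 E) E) ![posRealIdele E r, (posRealIdele E r)⁻¹] * M⁻¹,
        cayley_conj_diag_posRealIdele_mem_adelic F E c TW hTW hM r⟩)
      (P := stabDiagParabolicFin F (adelicGram F e TV TW) (isUnit_det_adelicGram F e hVd hWd) ⟨_, hg⟩)
      (u₀ := u₀) (hu₀ := hu₀) (hP := hP) (hR' := hgv') (hTs := hTs) (hp := hp) (M := posRealScalar (n + n) F r) (hM := hMz) Ψ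

end Summit.HodgeConjecture.HodgeConjecture.Cruxes.H413.E2SWBorelBoundFrame

end
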